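import Literature.AlgebraicGeometry.Resolution.MarkedIdealsEtale
import Literature.AlgebraicGeometry.Resolution.FlatSlicingCriterion
import Literature.AlgebraicGeometry.Resolution.RegularLocalRingsQuotient
import Literature.AlgebraicGeometry.Resolution.SmoothUniformizationProofs
import Literature.AlgebraicGeometry.Resolution.AlterationsLemma32
import Mathlib.AlgebraicGeometry.Morphisms.Smooth
import Mathlib.RingTheory.Flat.FaithfullyFlat.Basic
import HarnessLib

/-!
# [OURS · L1 W4.6 rung (ii)] SMOOTH MORPHISMS PRESERVE ORDERS OF IDEALS — flat local homomorphisms with regular closed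
# fibre preserve `𝔪`-adic orders; the stalk maps of a smooth morphism have regular closed fibres; regular centres pull
# back to regular centres, PROVED (the commutative algebra behind `…ThreefoldsGammaFreeGlobalSmooth.lean`)

Cell res-hironaka, LADDER-RESOLUTION rung L (D-0089), slot W4.6, rung (ii) (threefold hypersurfaces); seat res-L1-s46-pv-3
(gen 3). Host route MarkedTransfer, host item `HypersurfaceOrderReductionDimLeThree` (stmt-ResolutionOfSingularities-16156);
filed `--kind proof --supports` it `--as helper`. Everything here is OURS: kernel theorems over PROVED tree lemmas and
Mathlib; NOTHING is a statement of Hironaka's manuscript; no typed `Hironaka2017` candidate enters; no named FACT is a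
hypothesis. AI-written; AI review is weaker than expert review.

## What is proved (no new definitions)

* §1 `CampaignW46.map_le_maximalIdeal_pow_iff_of_flat_of_isRegularLocalRing_fibre` — **ORDERS OF IDEALS ARE PRESERVED BY
  FLAT LOCAL HOMOMORPHISMS WITH REGULAR CLOSED FIBRE**: for a local homomorphism `(R, 𝔪) → (S, 𝔫)` of Noetherian local
  rings with `S` flat over `R` and `S/𝔪S` a regular local ring, `I S ⊆ 𝔫^k ↔ I ⊆ 𝔪^k` for every ideal `I ⊆ R` and
  every `k`. Induction on `dim S/𝔪S` (`le_pow_of_map_le_pow_aux`): in dimension `0` the fibre is a field, `𝔪S = 𝔫`,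
  and faithful flatness gives `I S ∩ R = I`; in positive dimension lift a regular parameter `t̄` of the fibre to
  `t ∈ 𝔫`: by the slicing criterion (Matsumura, Cor. to Thm. 22.5, tree
  `Matsumura1987.isSMulRegular_and_flat_quotient_of_isSMulRegular_fiber`) `S/(t)` is flat over `R` with regular closed
  fibre `(S/𝔪S)/(t̄)` of dimension one less (Matsumura Thm. 14.2, tree `IsRegularLocalRing.quotient_span_singleton`),
  and `I S ⊆ 𝔫^k` passes to the quotient. (The étale case — fibre a finite separable field extension — is the tree's
  `map_le_maximalIdeal_pow_iff`; here the fibre may have any dimension.)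
* §2 `CampaignW46.isRegularLocalRing_fibre_stalkMap_of_smooth` — for a SMOOTH `φ : X′ ⟶ X` (`X` locally Noetherian)
  the closed fibre `𝒪_{X′,x′}/𝔪_{φ x′}𝒪_{X′,x′}` of every stalk map is a regular local ring (the stalk map is formally
  smooth and essentially of finite type; its fibre `κ(φ x′) ⊗ 𝒪_{X′,x′}` is formally smooth and essentially of finite
  type over a field, hence regular — the argument of the tree's `Grothendieck1967_17_5_8_holds` run on the stalks);
  `CampaignW46.le_idealOrder_comap_iff_of_smooth`, `CampaignW46.idealOrder_comap_eq_of_smooth` — **SMOOTH MORPHISMS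
  PRESERVE ORDERS**: `ord_{x′}(φ^*I) = ord_{φ x′}(I)` (the tree had the étale case `idealOrder_comap_of_etale`, and
  smooth morphisms between Kollár triples of equal dimension).
* §3 `CampaignW46.Scheme.IsRegular.subscheme_comap_of_smooth` — regular closed subschemes pull back to regular closed
  subschemes along smooth morphisms [EGA IV 17.5.8 (iii), tree `Scheme.IsRegular.of_smooth`].

HONEST VALUE. Classical commutative algebra / EGA IV bookkeeping, not previously in the tree in this generality; it is
the input of the smooth transfer principle for the Γ-free ladder (`…ThreefoldsGammaFreeGlobalSmooth.lean`), nothing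
about the manuscript.

References: tree `Resolution/FlatSlicingCriterion.lean` [Matsumura1987, Cor. to Thm. 22.5],
`Resolution/RegularLocalRingsQuotient.lean` (`IsRegularLocalRing.quotient_span_singleton`, `exists_not_mem_sq`
[Matsumura1987, Thm. 14.2]), `Resolution/RegularLocalRingsProofs.lean` (`isDomain_of_isRegularLocalRing` [Matsumura1987,
Thm. 14.3]), `Resolution/SmoothUniformizationProofs.lean` (`isRegularLocalRing_of_formallySmooth_of_essFiniteType`
[GortzWedhorn2020, Lemma 6.26]; pattern of `Grothendieck1967_17_5_8_holds`), `Resolution/SmoothImpliesRegular.lean`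
(`exists_ringKrullDim_eq_natCast`), `Resolution/AlterationsLemma32.lean` (`Scheme.IsRegular.of_smooth` [Grothendieck1967,
Prop. 17.5.8 (iii)]), `Resolution/MarkedIdealsEtale.lean` (`stalkIdeal_comap_eq_map`), Mathlib
(`Module.FaithfullyFlat.of_flat_of_isLocalHom`, `Ideal.comap_map_eq_self_of_faithfullyFlat` [Matsumura1987, Thm. 7.5],
`Algebra.FormallySmooth.of_isLocalization/comp/localization_base`, `Flat.stalkMap`). H. Hironaka, ms. 2017-03-23 —
scope only, under adjudication, not cited as fact. [Hironaka2017]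
-/

noncomputable section

set_option linter.dupNamespace false -- mandated namespace of this single-conjunct summit

open CategoryTheory CategoryTheory.Limits AlgebraicGeometry TopologicalSpace IsLocalRing
open scoped TensorProduct

namespace Summit.ResolutionOfSingularities.ResolutionOfSingularities.Theorems

namespace CampaignW46

open Literature.AlgebraicGeometry.Resolution
open Scheme.IdealSheafData

universe u
/-! ## §1 Orders along flat local homomorphisms with regular closed fibre -/

section FlatLocalOrder

section Quot

variable {S : Type u} [CommRing S] [IsLocalRing S]

/-- In a local ring, an element whose class in a quotient by an ideal inside the maximal ideal is a unit is itself a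
unit. [folklore] -/
theorem isUnit_of_isUnit_mk {I : Ideal S} (hI : I ≤ maximalIdeal S) {x : S}
    (hx : IsUnit (Ideal.Quotient.mk I x)) : IsUnit x := by
  by_contra hxu
  have hxm : x ∈ maximalIdeal S := hxu
  obtain ⟨v, hv⟩ := hx.exists_left_inv
  obtain ⟨y, rfl⟩ := Ideal.Quotient.mk_surjective v
  rw [← map_mul, ← map_one (Ideal.Quotient.mk I), Ideal.Quotient.eq] at hv
  have h1 : y * x ∈ maximalIdeal S := Ideal.mul_mem_left _ _ hxm
  have h3 : (1 : S) ∈ maximalIdeal S := by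
    have := sub_mem h1 (hI hv)
    rwa [sub_sub_cancel] at this
  exact (maximalIdeal.isMaximal S).ne_top (Ideal.eq_top_of_isUnit_mem _ h3 isUnit_one)

/-- The maximal ideal of a local ring maps into the maximal ideal of its quotient by an ideal inside the maximal ideal.
[folklore] -/
theorem map_mk_maximalIdeal_le {I : Ideal S} (hI : I ≤ maximalIdeal S) [Nontrivial (S ⧸ I)] :
    haveI := IsLocalRing.of_surjective' (Ideal.Quotient.mk I) Ideal.Quotient.mk_surjective
    (maximalIdeal S).map (Ideal.Quotient.mk I) ≤ maximalIdeal (S ⧸ I) := by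
  haveI := IsLocalRing.of_surjective' (Ideal.Quotient.mk I) Ideal.Quotient.mk_surjective
  rw [Ideal.map_le_iff_le_comap]
  intro x hx hu
  exact hx (isUnit_of_isUnit_mk hI hu)

end Quot

variable {R : Type u} [CommRing R] [IsLocalRing R] [IsNoetherianRing R]

omit [IsNoetherianRing R] in
/-- Along a local homomorphism the maximal ideal extends into the maximal ideal: `𝔪_R S ⊆ 𝔪_S`. [folklore] -/
theorem map_maximalIdeal_le_maximalIdeal' (S : Type u) [CommRing S] [IsLocalRing S] [Algebra R S]
    [IsLocalHom (algebraMap R S)] : (maximalIdeal R).map (algebraMap R S) ≤ maximalIdeal S := by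
  rw [Ideal.map_le_iff_le_comap]
  intro a ha
  exact map_nonunit (algebraMap R S) a ha

/-- **Order preservation along a flat local homomorphism with regular closed fibre — the induction on the dimension
`d` of the fibre** (see `map_le_maximalIdeal_pow_iff_of_flat_of_isRegularLocalRing_fibre`): `I S ⊆ 𝔫^k ⇒ I ⊆ 𝔪^k`.
`d = 0`: the fibre is a field, `𝔪S = 𝔫`, faithful flatness. `d + 1`: slice by a lift `t` of a regular parameter of
the fibre (slicing criterion: `S/(t)` flat over `R`; its fibre `(S/𝔪S)/(t̄)` regular of dimension `d`).
[cite: Matsumura1987, §22, Corollary to Thm. 22.5] -/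
theorem le_pow_of_map_le_pow_aux :
    ∀ (d : ℕ) (S : Type u) [CommRing S] [IsLocalRing S] [IsNoetherianRing S] [Algebra R S]
      [IsLocalHom (algebraMap R S)] [Module.Flat R S],
      IsRegularLocalRing (S ⧸ (maximalIdeal R).map (algebraMap R S)) →
      ringKrullDim (S ⧸ (maximalIdeal R).map (algebraMap R S)) = d →
      ∀ (I : Ideal R) (k : ℕ), I.map (algebraMap R S) ≤ maximalIdeal S ^ k → I ≤ maximalIdeal R ^ k := by
  intro d
  induction d with
  | zero =>
    intro S _ _ _ _ _ _ hfib hdim I k hI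
    set J : Ideal S := (maximalIdeal R).map (algebraMap R S) with hJ
    have hJle : J ≤ maximalIdeal S := map_maximalIdeal_le_maximalIdeal' S
    -- the fibre is a regular local ring of dimension `0`: its maximal ideal is `⊥`, so `𝔪_R S = 𝔪_S`
    have h0 : (maximalIdeal (S ⧸ J)).spanFinrank = 0 := by
      have h := hfib.spanFinrank_maximalIdeal
      rw [hdim] at h
      exact_mod_cast h
    have hbot : maximalIdeal (S ⧸ J) = ⊥ :=
      (Submodule.spanFinrank_eq_zero_iff_eq_bot (IsNoetherian.noetherian _)).mp h0
    have hJeq : maximalIdeal S = J := by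
      refine le_antisymm (fun x hx => ?_) hJle
      have hx' : Ideal.Quotient.mk J x ∈ maximalIdeal (S ⧸ J) := fun hu => hx (isUnit_of_isUnit_mk hJle hu)
      rw [hbot, Ideal.mem_bot, Ideal.Quotient.eq_zero_iff_mem] at hx'
      exact hx'
    -- faithful flatness
    haveI : Module.FaithfullyFlat R S := Module.FaithfullyFlat.of_flat_of_isLocalHom
    rw [hJeq, hJ, ← Ideal.map_pow] at hI
    rw [← Ideal.comap_map_eq_self_of_faithfullyFlat (B := S) I,
      ← Ideal.comap_map_eq_self_of_faithfullyFlat (B := S) (maximalIdeal R ^ k)]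
    exact Ideal.comap_mono hI
  | succ d ih =>
    intro S _ _ _ _ _ _ hfib hdim I k hI
    set J : Ideal S := (maximalIdeal R).map (algebraMap R S) with hJ
    have hJle : J ≤ maximalIdeal S := map_maximalIdeal_le_maximalIdeal' S
    -- a regular parameter `t̄` of the positive-dimensional regular fibre, lifted to `t ∈ S`
    have hdim0 : ringKrullDim (S ⧸ J) ≠ 0 := by
      rw [hdim]; exact_mod_cast Nat.succ_ne_zero d
    obtain ⟨tb, htb, htb2⟩ := IsRegularLocalRing.exists_not_mem_sq hdim0
    obtain ⟨t, rfl⟩ := Ideal.Quotient.mk_surjective tb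
    have htS : t ∈ maximalIdeal S := fun hu => htb (hu.map _)
    -- `t̄` is a nonzerodivisor of the domain `S/J`
    haveI : IsDomain (S ⧸ J) := isDomain_of_isRegularLocalRing (S ⧸ J)
    have htb0 : Ideal.Quotient.mk J t ≠ 0 := fun h => htb2 (h ▸ zero_mem _)
    have hreg : IsSMulRegular (S ⧸ J) t := by
      intro a b hab
      have hab' : Ideal.Quotient.mk J t * a = Ideal.Quotient.mk J t * b := by
        simpa [Algebra.smul_def] using hab
      exact mul_left_cancel₀ htb0 hab'
    -- slicing criterion: `S/(t)` is flat over `R`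
    obtain ⟨-, hflat⟩ :=
      Matsumura1987.isSMulRegular_and_flat_quotient_of_isSMulRegular_fiber (A := R) (B := S) hreg
    -- the slice `S₁ = S/(t)`: a Noetherian local flat `R`-algebra with local structure map
    have ht1 : Ideal.span {t} ≤ maximalIdeal S := (Ideal.span_singleton_le_iff_mem _).mpr htS
    have hne : Ideal.span {t} ≠ ⊤ := fun h => (maximalIdeal.isMaximal S).ne_top (top_le_iff.mp (h ▸ ht1))
    haveI : Nontrivial (S ⧸ Ideal.span {t}) := Ideal.Quotient.nontrivial_iff.mpr hne
    haveI : IsLocalRing (S ⧸ Ideal.span {t}) :=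
      IsLocalRing.of_surjective' (Ideal.Quotient.mk _) Ideal.Quotient.mk_surjective
    haveI : IsLocalHom (algebraMap R (S ⧸ Ideal.span {t})) := by
      refine ⟨fun a ha => ?_⟩
      rw [IsScalarTower.algebraMap_apply R S (S ⧸ Ideal.span {t}), Ideal.Quotient.algebraMap_eq] at ha
      exact (isUnit_map_iff (algebraMap R S) a).mp (isUnit_of_isUnit_mk ht1 ha)
    haveI : Module.Flat R (S ⧸ Ideal.span {t}) := hflat
    -- its fibre is the slice of the fibre: `S₁/𝔪S₁ ≅ (S/J)/(t̄)`, regular of dimension `d`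
    set J₁ : Ideal (S ⧸ Ideal.span {t}) := (maximalIdeal R).map (algebraMap R (S ⧸ Ideal.span {t})) with hJ₁
    have hJ₁eq : J₁ = J.map (Ideal.Quotient.mk (Ideal.span {t})) := by
      rw [hJ₁, hJ, Ideal.map_map, ← Ideal.Quotient.algebraMap_eq, ← IsScalarTower.algebraMap_eq]
    have hspan : (Ideal.span {t}).map (Ideal.Quotient.mk J) = Ideal.span {Ideal.Quotient.mk J t} := by
      rw [Ideal.map_span, Set.image_singleton]
    let e : (S ⧸ Ideal.span {t}) ⧸ J₁ ≃+* (S ⧸ J) ⧸ Ideal.span {Ideal.Quotient.mk J t} :=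
      (Ideal.quotEquivOfEq hJ₁eq).trans <|
        (DoubleQuot.quotQuotEquivQuotSup (Ideal.span {t}) J).trans <|
          (Ideal.quotEquivOfEq (sup_comm _ _)).trans <|
            (DoubleQuot.quotQuotEquivQuotSup J (Ideal.span {t})).symm.trans (Ideal.quotEquivOfEq hspan)
    obtain ⟨hreg₁, hdim₁⟩ := IsRegularLocalRing.quotient_span_singleton htb htb2
    haveI := hreg₁
    have hfib₁ : IsRegularLocalRing ((S ⧸ Ideal.span {t}) ⧸ J₁) := IsRegularLocalRing.of_ringEquiv e.symm
    have hdim₁' : ringKrullDim ((S ⧸ Ideal.span {t}) ⧸ J₁) = d := by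
      rw [ringKrullDim_eq_of_ringEquiv e]
      obtain ⟨n, hn⟩ := exists_ringKrullDim_eq_natCast ((S ⧸ J) ⧸ Ideal.span {Ideal.Quotient.mk J t})
      rw [hn, hdim] at hdim₁
      rw [hn]
      have : n + 1 = d + 1 := by exact_mod_cast hdim₁
      have : n = d := by omega
      rw [this]
    -- induction hypothesis on the slice
    refine ih (S ⧸ Ideal.span {t}) hfib₁ hdim₁' I k ?_
    rw [IsScalarTower.algebraMap_eq R S (S ⧸ Ideal.span {t}), Ideal.Quotient.algebraMap_eq, ← Ideal.map_map]
    refine (Ideal.map_mono hI).trans ?_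
    rw [Ideal.map_pow]
    exact Ideal.pow_right_mono (map_mk_maximalIdeal_le ht1) k

/-- **ORDERS OF IDEALS ARE PRESERVED BY FLAT LOCAL HOMOMORPHISMS WITH REGULAR CLOSED FIBRE**: for a local homomorphism
`(R, 𝔪) → (S, 𝔫)` of Noetherian local rings, `S` flat over `R`, `S/𝔪S` a regular local ring, and every ideal `I ⊆ R`
and `k ∈ ℕ`: `I S ⊆ 𝔫^k ↔ I ⊆ 𝔪^k` (so `ord_𝔫(I S) = ord_𝔪(I)`). The case `S/𝔪S` a field separable over `R/𝔪`
(étale) is the tree's `map_le_maximalIdeal_pow_iff`; here the fibre may have any dimension (smooth morphisms).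
[cite: Matsumura1987, §22, Corollary to Thm. 22.5] -/
theorem map_le_maximalIdeal_pow_iff_of_flat_of_isRegularLocalRing_fibre (S : Type u) [CommRing S] [IsLocalRing S]
    [IsNoetherianRing S] [Algebra R S] [IsLocalHom (algebraMap R S)] [Module.Flat R S]
    [hfib : IsRegularLocalRing (S ⧸ (maximalIdeal R).map (algebraMap R S))] (I : Ideal R) (k : ℕ) :
    I.map (algebraMap R S) ≤ maximalIdeal S ^ k ↔ I ≤ maximalIdeal R ^ k := by
  constructor
  · obtain ⟨d, hd⟩ := exists_ringKrullDim_eq_natCast (S ⧸ (maximalIdeal R).map (algebraMap R S))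
    exact le_pow_of_map_le_pow_aux d S hfib hd I k
  · intro h
    refine (Ideal.map_mono h).trans ?_
    rw [Ideal.map_pow]
    exact Ideal.pow_right_mono (map_maximalIdeal_le_maximalIdeal' S) k


end FlatLocalOrder

/-! ## §2 Smooth morphisms preserve orders of ideals -/

section SmoothOrder

/-- **The closed fibre of every stalk map of a SMOOTH morphism is a regular local ring**: for `φ : X′ ⟶ X` smooth, `X`
locally Noetherian, and `x′ : X′`, the ring `𝒪_{X′,x′} / 𝔪_{φ x′} 𝒪_{X′,x′}` is regular local. (Affine-locally
`Γ(X, U) → Γ(X′, V)` is a smooth ring map; localising, the stalk map is formally smooth and essentially of finite type,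
so its fibre `κ(φ x′) ⊗ 𝒪_{X′,x′}` is formally smooth and essentially of finite type over the field `κ(φ x′)`, hence
regular — the argument of the tree's `Grothendieck1967_17_5_8_holds`, run on the scheme's stalks.)
[cite: Grothendieck1967, Prop. 17.5.8 (iii) (PDF p. 69)] -/
theorem isRegularLocalRing_fibre_stalkMap_of_smooth {X' X : Scheme.{u}} (φ : X' ⟶ X) [Smooth φ]
    [IsLocallyNoetherian X] (x' : X') :
    IsRegularLocalRing (X'.presheaf.stalk x' ⧸
      (maximalIdeal (X.presheaf.stalk (φ x'))).map (φ.stalkMap x').hom) := by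
  haveI : IsLocallyNoetherian X' := LocallyOfFiniteType.isLocallyNoetherian φ
  obtain ⟨U, hU, hxU, -⟩ :=
    exists_isAffineOpen_mem_and_subset (X := X) (x := φ x') (U := ⊤) trivial
  obtain ⟨V, hV, hxV, hVU⟩ :=
    exists_isAffineOpen_mem_and_subset (X := X') (x := x') (U := φ ⁻¹ᵁ U) hxU
  set Rp := X.presheaf.stalk (φ x') with hRp
  set Sq := X'.presheaf.stalk x' with hSq
  letI algAB : Algebra Γ(X, U) Γ(X', V) := (φ.appLE U V hVU).hom.toAlgebra
  letI algARp : Algebra Γ(X, U) Rp := (X.presheaf.germ U (φ x') hxU).hom.toAlgebra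
  letI algBSq : Algebra Γ(X', V) Sq := (X'.presheaf.germ V x' hxV).hom.toAlgebra
  letI algRS : Algebra Rp Sq := (φ.stalkMap x').hom.toAlgebra
  letI algASq : Algebra Γ(X, U) Sq :=
    ((X'.presheaf.germ V x' hxV).hom.comp (φ.appLE U V hVU).hom).toAlgebra
  haveI : IsScalarTower Γ(X, U) Γ(X', V) Sq := IsScalarTower.of_algebraMap_eq (fun a => rfl)
  haveI : IsScalarTower Γ(X, U) Rp Sq := IsScalarTower.of_algebraMap_eq (fun a => by
    change (X'.presheaf.germ V x' hxV).hom ((φ.appLE U V hVU).hom a) =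
      (φ.stalkMap x').hom ((X.presheaf.germ U (φ x') hxU).hom a)
    rw [← CommRingCat.comp_apply, ← CommRingCat.comp_apply, Scheme.Hom.germ_stalkMap, Scheme.Hom.appLE,
      Category.assoc, X'.presheaf.germ_res (homOfLE hVU) x' hxV])
  haveI : IsLocalization.AtPrime Rp (hU.primeIdealOf ⟨φ x', hxU⟩).asIdeal := hU.isLocalization_stalk ⟨φ x', hxU⟩
  haveI : IsLocalization.AtPrime Sq (hV.primeIdealOf ⟨x', hxV⟩).asIdeal := hV.isLocalization_stalk ⟨x', hxV⟩
  -- smoothness of the affine piece, formal smoothness of the stalk map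
  have hsm : (φ.appLE U V hVU).hom.Smooth := HasRingHomProperty.appLE @Smooth φ inferInstance ⟨U, hU⟩ ⟨V, hV⟩ hVU
  haveI : Algebra.Smooth Γ(X, U) Γ(X', V) := hsm
  haveI : Algebra.FormallySmooth Γ(X', V) Sq :=
    Algebra.FormallySmooth.of_isLocalization (hV.primeIdealOf ⟨x', hxV⟩).asIdeal.primeCompl
  haveI : Algebra.FormallySmooth Γ(X, U) Sq := Algebra.FormallySmooth.comp Γ(X, U) Γ(X', V) Sq
  haveI : Algebra.FormallySmooth Rp Sq :=
    Algebra.FormallySmooth.localization_base (hU.primeIdealOf ⟨φ x', hxU⟩).asIdeal.primeCompl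
  haveI : Algebra.EssFiniteType Rp Sq := by
    rw [← RingHom.essFiniteType_algebraMap, RingHom.algebraMap_toAlgebra]
    exact LocallyOfFiniteType.stalkMap φ x'
  haveI : IsLocalHom (algebraMap Rp Sq) := inferInstanceAs <| IsLocalHom (φ.stalkMap x').hom
  -- the closed fibre `κ(𝔪_R) ⊗ S ≅ S/𝔪_R S` is formally smooth and essentially of finite type over a field
  haveI : IsRegularLocalRing (ResidueField Rp ⊗[Rp] Sq) :=
    isRegularLocalRing_of_formallySmooth_of_essFiniteType (ResidueField Rp) _
  let e : ResidueField Rp ⊗[Rp] Sq ≃+* Sq ⧸ (maximalIdeal Rp).map (algebraMap Rp Sq) :=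
    (Algebra.TensorProduct.comm Rp (ResidueField Rp) Sq).toRingEquiv.trans
      (Algebra.TensorProduct.quotIdealMapEquivTensorQuot Sq (maximalIdeal Rp)).toRingEquiv.symm
  exact IsRegularLocalRing.of_ringEquiv e


/-- **SMOOTH MORPHISMS PRESERVE ORDERS, `≤`-form**: `n ≤ ord_{x′}(φ^* I) ↔ n ≤ ord_{φ x′}(I)` for `φ : X′ ⟶ X` smooth, `X`
locally Noetherian (the stalk map is flat and local with regular closed fibre, §1–§2). [cite: Matsumura1987, §22, Corollary to Thm. 22.5] -/
theorem le_idealOrder_comap_iff_of_smooth {X' X : Scheme.{u}} (φ : X' ⟶ X) [Smooth φ] [IsLocallyNoetherian X]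
    (I : X.IdealSheafData) (x' : X') (n : ℕ) :
    (n : ℕ∞) ≤ idealOrder (I.comap φ) x' ↔ (n : ℕ∞) ≤ idealOrder I (φ x') := by
  haveI : IsLocallyNoetherian X' := LocallyOfFiniteType.isLocallyNoetherian φ
  rw [le_idealOrder_iff, le_idealOrder_iff, stalkIdeal_comap_eq_map]
  algebraize [(φ.stalkMap x').hom]
  haveI : IsLocalHom (algebraMap (X.presheaf.stalk (φ x')) (X'.presheaf.stalk x')) :=
    inferInstanceAs <| IsLocalHom (φ.stalkMap x').hom
  haveI : Module.Flat (X.presheaf.stalk (φ x')) (X'.presheaf.stalk x') := Flat.stalkMap φ x'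
  haveI : IsRegularLocalRing (X'.presheaf.stalk x' ⧸
      (maximalIdeal (X.presheaf.stalk (φ x'))).map (algebraMap (X.presheaf.stalk (φ x')) (X'.presheaf.stalk x'))) :=
    isRegularLocalRing_fibre_stalkMap_of_smooth φ x'
  exact map_le_maximalIdeal_pow_iff_of_flat_of_isRegularLocalRing_fibre (X'.presheaf.stalk x') (stalkIdeal I (φ x')) n

/-- **SMOOTH MORPHISMS PRESERVE ORDERS OF IDEALS**: `ord_{x′}(φ^* I) = ord_{φ x′}(I)` for `φ : X′ ⟶ X` smooth and `X`
locally Noetherian (e.g. the projection `X × 𝔸ⁿ → X`, an open immersion, an étale morphism).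
[cite: Matsumura1987, §22, Corollary to Thm. 22.5] -/
theorem idealOrder_comap_eq_of_smooth {X' X : Scheme.{u}} (φ : X' ⟶ X) [Smooth φ] [IsLocallyNoetherian X]
    (I : X.IdealSheafData) (x' : X') : idealOrder (I.comap φ) x' = idealOrder I (φ x') :=
  ENat.eq_of_forall_natCast_le_iff fun n => le_idealOrder_comap_iff_of_smooth φ I x' n

end SmoothOrder

/-! ## §3 Regular centres pull back to regular centres along smooth morphisms -/

/-- **Regular closed subschemes pull back to regular closed subschemes along smooth morphisms**: if `V(C) ⊆ X` is
regular, `X` locally Noetherian and `φ : X′ ⟶ X` smooth, then `V(φ^*C) = V(C) ×_X X′` is regular (smooth over regular is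
regular, EGA IV 17.5.8 (iii), tree `Scheme.IsRegular.of_smooth`; the comparison isomorphism `(φ^*C).subscheme ≅
pullback φ ι_C` is Mathlib's `comapIso`). [cite: Grothendieck1967, Prop. 17.5.8 (iii) (PDF p. 69)] -/
theorem Scheme.IsRegular.subscheme_comap_of_smooth {X' X : Scheme.{u}} (φ : X' ⟶ X) [Smooth φ]
    [IsLocallyNoetherian X] (C : X.IdealSheafData) (hC : Scheme.IsRegular C.subscheme) :
    Scheme.IsRegular (C.comap φ).subscheme := by
  haveI : IsLocallyNoetherian C.subscheme := LocallyOfFiniteType.isLocallyNoetherian C.subschemeι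
  haveI : Smooth (pullback.snd φ C.subschemeι) := MorphismProperty.pullback_snd _ _ inferInstance
  have hP : Scheme.IsRegular (pullback φ C.subschemeι) := Scheme.IsRegular.of_smooth (pullback.snd φ C.subschemeι) hC
  exact hP.of_iso (C.comapIso φ).inv

end CampaignW46

end Summit.ResolutionOfSingularities.ResolutionOfSingularities.Theorems

end
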